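import Literature.RingTheory.MvPolynomial.HypersurfaceLineTaylor
import Literature.RingTheory.MvPolynomial.HypersurfaceLineSpecialization
import HarnessLib

/-!
# The generic line of a surface in an asymptotic direction constant along itself

Topic `Literature/RingTheory/MvPolynomial`. Everything in this file is PROVED. The common core of
the three cases of Monge's theorem "flecnodal / parabolic (developable) / planar `⟹` ruled"
[Kollar2015, Thm. 13, §6] in the function-field language of `HypersurfaceFunctionField.lean`
(`L = K(S)`, graph derivations `D₀, D₁`, `z̄ = x̄₂`, `p̄ = D₀z̄`, `q̄ = D₁z̄`,
`r = D₀p̄`, `s = D₁p̄ = D₀q̄`, `t = D₁q̄`).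

**Theorem** (`Hypersurface.aeval_line_eq_zero_of_II_eq_zero`). Let `L'` be a field extension of
`L`, `Δ` a `K`-derivation of `L'` and `α, β ∈ L'` such that
* `Δ` restricts to `α D₀ + β D₁` on `L`,
* `Δα = Δβ = 0` (the direction is constant along itself), and
* `II(α, β) := α² r + 2αβ s + β² t = 0` (the direction is asymptotic).
Then the line through the generic point `(x̄₀, x̄₁, z̄)` with direction
`(α, β, α p̄ + β q̄)` lies on the surface: `f(x̄₀ + αt, x̄₁ + βt, z̄ + (αp̄ + βq̄)t) = 0` in
`L'[t]` (assuming `k!` invertible for `k ≤ deg f` and `∂₂f ∉ (f)`).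

Proof: the truncated exponential of `Δ` (`HypersurfaceLineTaylor.lean`) is a homomorphism
modulo `t^{N+1}` and kills `f(x̄) = 0`; under the hypotheses `Δ²` kills `x̄₀, x̄₁, z̄`
(`Δ(αp̄ + βq̄) = II(α,β) = 0` by the symmetry `D₀D₁ = D₁D₀`), so `exp(tΔ)x̄` IS the line.
Also recorded: the first two osculating polynomials `T₁ = p̄ + q̄σ`, `T₂ = r + 2sσ + tσ²`.

## References
* [Kollar2015] J. Kollár, *Szemerédi–Trotter-type theorems in dimension 3*, Adv. Math. 271
  (2015), Theorem 13 and §6.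
-/

namespace Literature.RingTheory.MvPolynomial

open Polynomial Finset
open scoped Nat

/-! ### Degree of a substitution of degree-`≤ 1` polynomials -/

section Degree

variable {K : Type*} [Field K] {A : Type*} [CommRing A] [Algebra K A] {ι : Type*}

/-- Substituting polynomials of degree `≤ 1` into `P ∈ K[ι]` gives a polynomial of degree
`≤ deg P`. [folklore] -/
theorem natDegree_aeval_le_totalDegree (v : ι → A[X]) (hv : ∀ i, (v i).natDegree ≤ 1)
    (P : MvPolynomial ι K) : (MvPolynomial.aeval v P).natDegree ≤ P.totalDegree := by
  classical
  rw [MvPolynomial.aeval_def, MvPolynomial.eval₂_eq]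
  refine Polynomial.natDegree_sum_le_of_forall_le _ _ fun d hd => ?_
  refine Polynomial.natDegree_mul_le.trans ?_
  have h0 : (algebraMap K A[X] (MvPolynomial.coeff d P)).natDegree = 0 := by
    rw [Polynomial.algebraMap_apply, Polynomial.natDegree_C]
  rw [h0, zero_add]
  refine (Polynomial.natDegree_prod_le _ _).trans ?_
  calc ∑ i ∈ d.support, (v i ^ d i).natDegree ≤ ∑ i ∈ d.support, d i := by
        refine Finset.sum_le_sum fun i _ => ?_
        exact Polynomial.natDegree_pow_le.trans
          ((Nat.mul_le_mul_left _ (hv i)).trans (mul_one _).le)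
    _ ≤ P.totalDegree := MvPolynomial.le_totalDegree hd

/-- The entries of a polynomial line `a + t v` have degree `≤ 1`. [folklore] -/
theorem natDegree_C_add_C_mul_X_le (a v : A) : (C a + C v * X).natDegree ≤ 1 :=
  (natDegree_add_le _ _).trans (max_le (by rw [natDegree_C]; exact Nat.zero_le _)
    ((natDegree_C_mul_le _ _).trans natDegree_X_le))

end Degree

/-! ### Truncated exponentials of `Δ`-affine elements -/

section TruncExpLinear

variable {K : Type*} [Field K] {B : Type*} [CommRing B] [Algebra K B]

/-- If `δ b = w` and `δ w = 0` then `exp_N(tδ) b = b + w t` (`N ≥ 1`). [folklore] -/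
theorem truncExp_eq_of_apply_apply_eq_zero {N : ℕ} (hN1 : 1 ≤ N) (δ : Derivation K B B)
    {b w : B} (h1 : δ b = w) (h2 : δ w = 0) : truncExp N δ b = C b + C w * X := by
  have hk : ∀ k, δ^[k + 2] b = 0 := by
    intro k
    rw [Function.iterate_add_apply, Function.iterate_succ_apply, Function.iterate_one, h1, h2]
    exact Function.iterate_fixed (map_zero _) k
  refine Polynomial.ext fun n => ?_
  rw [coeff_truncExp, coeff_add, coeff_C, coeff_C_mul_X]
  match n with
  | 0 => simp
  | 1 => simp [h1, hN1]
  | n + 2 =>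
    rw [if_neg (show n + 2 ≠ 0 by omega), if_neg (show n + 2 ≠ 1 by omega), add_zero]
    split_ifs
    · rw [hk n, smul_zero]
    · rfl

end TruncExpLinear

namespace Hypersurface

variable {K : Type*} [Field K] {f : MvPolynomial (Fin 3) K} [Fact (Irreducible f)]

/-! ### The first two osculating polynomials -/

/-- `T₁ = p̄ + q̄ σ`. [folklore] -/
theorem osc_one : osc f 1 = C (gD f 0 (toFn f (MvPolynomial.X 2))) +
    X * C (gD f 1 (toFn f (MvPolynomial.X 2))) := by
  rw [osc_succ, osc_zero, slopeDeriv_C]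

/-- `T₂ = r + 2 s σ + t σ²` (`s = D₁p̄ = D₀q̄` by the symmetry of the graph derivations).
[folklore] -/
theorem osc_two (h2 : toFn f (MvPolynomial.pderiv 2 f) ≠ 0) :
    osc f 2 = C (gD f 0 (gD f 0 (toFn f (MvPolynomial.X 2)))) +
      C (2 * gD f 1 (gD f 0 (toFn f (MvPolynomial.X 2)))) * X +
      C (gD f 1 (gD f 1 (toFn f (MvPolynomial.X 2)))) * X ^ 2 := by
  rw [osc_succ, osc_one, map_add, Derivation.leibniz, slopeDeriv_X, smul_zero, add_zero,
    slopeDeriv_C, slopeDeriv_C, smul_eq_mul, gD_comm h2, map_mul, C_ofNat]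
  ring

/-- `T₂(s) = II(1, s)`. [folklore] -/
theorem aeval_osc_two (h2 : toFn f (MvPolynomial.pderiv 2 f) ≠ 0) {A : Type*} [CommRing A]
    [Algebra (FnField f) A] (s : A) :
    aeval s (osc f 2) = algebraMap (FnField f) A (gD f 0 (gD f 0 (toFn f (MvPolynomial.X 2)))) +
      2 * s * algebraMap (FnField f) A (gD f 1 (gD f 0 (toFn f (MvPolynomial.X 2)))) +
      s ^ 2 * algebraMap (FnField f) A (gD f 1 (gD f 1 (toFn f (MvPolynomial.X 2)))) := by
  rw [osc_two h2]
  simp only [map_add, map_mul, aeval_C, aeval_X, map_pow, map_ofNat]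
  ring

/-! ### `f` vanishes at the generic point -/

/-- `f(x̄₀, x̄₁, x̄₂) = 0` in `L`. [folklore] -/
theorem aeval_toFn_X (f : MvPolynomial (Fin 3) K) [Fact (Irreducible f)] :
    MvPolynomial.aeval (fun i => toFn f (MvPolynomial.X i)) f = 0 := by
  have h1 : MvPolynomial.aeval (fun i => toFn f (MvPolynomial.X i)) f = toFn f f := by
    conv_rhs => rw [MvPolynomial.aeval_unique (toFn f)]
    rfl
  rw [h1, toFn_self]

/-- `f(x̄₀, x̄₁, x̄₂) = 0` in any `L`-algebra. [folklore] -/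
theorem aeval_algebraMap_toFn_X (f : MvPolynomial (Fin 3) K) [Fact (Irreducible f)]
    {A : Type*} [CommRing A] [Algebra K A] [Algebra (FnField f) A]
    [IsScalarTower K (FnField f) A] :
    MvPolynomial.aeval (fun i => algebraMap (FnField f) A (toFn f (MvPolynomial.X i))) f = 0 := by
  have key := ringHom_mvPolynomial_aeval (K := K) (algebraMap (FnField f) A)
    (fun c => (IsScalarTower.algebraMap_apply K (FnField f) A c).symm)
    (fun i => toFn f (MvPolynomial.X i)) f
  rw [aeval_toFn_X, map_zero] at key
  exact key.symm

/-! ### The criterion -/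

/-- **The generic line in an asymptotic direction that is constant along itself lies on the
surface.** Let `k!` be invertible in `K` for `k ≤ deg f`, `∂₂f ∉ (f)`, `L'` a field extension
of `L = K(S)`, `Δ` a `K`-derivation of `L'` restricting to `αD₀ + βD₁` on `L` with
`Δα = Δβ = 0` and `α² r + 2αβ s + β² t = 0`. Then
`f(x̄₀ + αt, x̄₁ + βt, z̄ + (αp̄ + βq̄)t) = 0` in `L'[t]`. (Common core of the flecnodal,
parabolic and planar cases of Monge's theorem.) [cite: Kollar2015, Theorem 13 and §6] -/
theorem aeval_line_eq_zero_of_II_eq_zero {L' : Type*} [Field L'] [Algebra K L']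
    [Algebra (FnField f) L'] [IsScalarTower K (FnField f) L']
    (h2 : toFn f (MvPolynomial.pderiv 2 f) ≠ 0)
    (hfac : ∀ k, k ≤ f.totalDegree → ((k ! : ℕ) : K) ≠ 0)
    (Δ : Derivation K L' L') (α β : L') (hα : Δ α = 0) (hβ : Δ β = 0)
    (hΔ : ∀ u, Δ (algebraMap (FnField f) L' u) =
      α * algebraMap (FnField f) L' (gD f 0 u) + β * algebraMap (FnField f) L' (gD f 1 u))
    (hII : α ^ 2 * algebraMap (FnField f) L' (gD f 0 (gD f 0 (toFn f (MvPolynomial.X 2)))) +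
      2 * α * β * algebraMap (FnField f) L' (gD f 1 (gD f 0 (toFn f (MvPolynomial.X 2)))) +
      β ^ 2 * algebraMap (FnField f) L' (gD f 1 (gD f 1 (toFn f (MvPolynomial.X 2)))) = 0) :
    MvPolynomial.aeval (fun i => C (algebraMap (FnField f) L' (toFn f (MvPolynomial.X i))) +
      C (![α, β, α * algebraMap (FnField f) L' (gD f 0 (toFn f (MvPolynomial.X 2))) +
        β * algebraMap (FnField f) L' (gD f 1 (toFn f (MvPolynomial.X 2)))] i) * X) f = 0 := by
  have hf : Irreducible f := Fact.out
  have hN1 : 1 ≤ f.totalDegree := by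
    by_contra h0
    push Not at h0
    have hfC : f = MvPolynomial.C (MvPolynomial.coeff 0 f) :=
      MvPolynomial.totalDegree_eq_zero_iff_eq_C.1 (by omega)
    refine hf.not_isUnit ?_
    rw [hfC]
    refine MvPolynomial.isUnit_iff_eq_C_of_isReduced.2 ⟨MvPolynomial.coeff 0 f, ?_, rfl⟩
    exact isUnit_iff_ne_zero.2 fun hc => hf.ne_zero (by rw [hfC, hc, MvPolynomial.C_0])
  have h02 : (0 : Fin 3) ≠ 2 := by decide
  have h12 : (1 : Fin 3) ≠ 2 := by decide
  have h01 : (0 : Fin 3) ≠ 1 := by decide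
  have h10 : (1 : Fin 3) ≠ 0 := by decide
  -- the values of `Δ` on the coordinates and on the direction
  have hD0 : Δ (algebraMap (FnField f) L' (toFn f (MvPolynomial.X 0))) = α := by
    rw [hΔ, gD_X_self h2 h02, gD_X_of_ne h2 h12 h01 h02, map_one, map_zero, mul_one, mul_zero,
      add_zero]
  have hD1 : Δ (algebraMap (FnField f) L' (toFn f (MvPolynomial.X 1))) = β := by
    rw [hΔ, gD_X_of_ne h2 h02 h10 h12, gD_X_self h2 h12, map_one, map_zero, mul_one, mul_zero,
      zero_add]
  have hD2 : Δ (algebraMap (FnField f) L' (toFn f (MvPolynomial.X 2))) =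
      α * algebraMap (FnField f) L' (gD f 0 (toFn f (MvPolynomial.X 2))) +
        β * algebraMap (FnField f) L' (gD f 1 (toFn f (MvPolynomial.X 2))) := hΔ _
  have hDw : Δ (α * algebraMap (FnField f) L' (gD f 0 (toFn f (MvPolynomial.X 2))) +
      β * algebraMap (FnField f) L' (gD f 1 (toFn f (MvPolynomial.X 2)))) = 0 := by
    rw [map_add, Derivation.leibniz, Derivation.leibniz, hα, hβ, smul_zero, smul_zero, add_zero,
      add_zero, smul_eq_mul, smul_eq_mul, hΔ, hΔ, gD_comm h2]
    linear_combination hII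
  -- the truncated exponentials of the coordinates ARE the line
  have hv : (fun i => truncExp f.totalDegree Δ
      (algebraMap (FnField f) L' (toFn f (MvPolynomial.X i)))) =
      fun i => C (algebraMap (FnField f) L' (toFn f (MvPolynomial.X i))) +
        C (![α, β, α * algebraMap (FnField f) L' (gD f 0 (toFn f (MvPolynomial.X 2))) +
          β * algebraMap (FnField f) L' (gD f 1 (toFn f (MvPolynomial.X 2)))] i) * X := by
    funext i
    match i with
    | 0 =>
      rw [Matrix.cons_val_zero]
      exact truncExp_eq_of_apply_apply_eq_zero hN1 Δ hD0 hα
    | 1 =>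
      rw [Matrix.cons_val_one, Matrix.cons_val_zero]
      exact truncExp_eq_of_apply_apply_eq_zero hN1 Δ hD1 hβ
    | 2 =>
      simp only [Matrix.cons_val]
      exact truncExp_eq_of_apply_apply_eq_zero hN1 Δ hD2 hDw
  -- coefficients `≤ deg f` vanish by the exponential, the others by degree
  refine Polynomial.ext fun n => ?_
  rw [coeff_zero]
  by_cases hn : n ≤ f.totalDegree
  · have key := coeff_truncExp_aeval hfac Δ
      (fun i => algebraMap (FnField f) L' (toFn f (MvPolynomial.X i))) f hn
    rw [aeval_algebraMap_toFn_X, truncExp_zero, coeff_zero, hv] at key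
    exact key.symm
  · push Not at hn
    exact coeff_eq_zero_of_natDegree_lt ((natDegree_aeval_le_totalDegree _
      (fun i => natDegree_C_add_C_mul_X_le _ _) f).trans_lt hn)

end Hypersurface

end Literature.RingTheory.MvPolynomial
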